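import Mathlib

/-!
# Kernel certificate: the biquadratic norm decomposition behind Theorem 2′ (a) of P2-D4TripleClasses (seat p2 (g6), pub-hodge-repro0)

Setting (abstract): a field `F` with two commuting involutive ring automorphisms `s`, `ρ` (in the application `F` is the Galois
closure of a D₄ quartic CM field, `Gal(F/K₀) = {1, s, ρ, ρs}`, `K = F^⟨s⟩`, `F₀ = F^⟨ρ⟩`, `K′ = F^⟨ρs⟩`, and
`N_{F/K′}(φ) = φ · ρ(s(φ))`, `N_{K/K₀}(κ) = κ · ρ(κ)` for `κ ∈ K`, `N_{F₀/K₀}(η) = η · s(η)` for `η ∈ F₀`).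

* `norm_product`: for `κ` with `s κ = κ` and `η` with `ρ η = η`, `N_{F/K′}(κ η) = N_{K/K₀}(κ) · N_{F₀/K₀}(η)` — the direction «⇐» of
  Theorem 2′ (a) (a ring identity).
* `norm_decomp`: if `x = N_{F/K′}(φ)` is `s`-invariant (i.e. lies in `K₀ = F^⟨s, ρ⟩` — it is `ρs`-invariant automatically), and if `F`
  contains an element `η₀ ≠ 0` with `ρ η₀ = η₀`, `s η₀ = −η₀` (in the application `η₀ = √m`), then `x = N_{K/K₀}(κ) · N_{F₀/K₀}(η)`
  for explicit `κ` with `s κ = κ` and `η` with `ρ η = η` — the direction «⇒», the explicit Hilbert 90 of the page's proof: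
  `κ = φ·s(φ)/(φ + s(φ))`, `η = (φ + s(φ))/s(φ)` when `φ + s(φ) ≠ 0`, and `κ = φ/η₀`, `η = η₀` when `s(φ) = −φ`.

Together: `K₀^× ∩ N_{F/K′}(F^×) = N_{K/K₀}(K^×) · N_{F₀/K₀}(F₀^×)` (Theorem 2′ (a)); with the Hasse norm theorem for the cyclic
`F/K′` (Ne99-3, held) this is the local characterisation of the classes attained by `B₀ = A* × A*`. No axiom beyond Mathlib's.
-/

namespace HodgeRepro0.P2D4TripleClassesH90

variable {F : Type*} [Field F]

/-- «⇐» of Theorem 2′ (a): `N_{F/K′}(κ η) = N_{K/K₀}(κ) · N_{F₀/K₀}(η)` for `κ ∈ K = F^⟨s⟩`, `η ∈ F₀ = F^⟨ρ⟩`. -/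
theorem norm_product (s ρ : F ≃+* F) (hc : ∀ y, s (ρ y) = ρ (s y)) (κ η : F) (hκ : s κ = κ) (hη : ρ η = η) :
    (κ * η) * ρ (s (κ * η)) = (κ * ρ κ) * (η * s η) := by
  have h1 : ρ (s η) = s η := by rw [← hc, hη]
  rw [map_mul s, hκ, map_mul ρ, h1]
  ring

/-- «⇒» of Theorem 2′ (a), the explicit Hilbert 90: an `s`-invariant norm `φ · ρ(s φ)` from `F` to `K′ = F^⟨ρs⟩` is a product
`N_{K/K₀}(κ) · N_{F₀/K₀}(η)` with `κ ∈ K = F^⟨s⟩`, `η ∈ F₀ = F^⟨ρ⟩`, given some `η₀ ≠ 0` with `ρ η₀ = η₀`, `s η₀ = −η₀`. -/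
theorem norm_decomp (s ρ : F ≃+* F) (hs : ∀ y, s (s y) = y) (hρ : ∀ y, ρ (ρ y) = y)
    (hc : ∀ y, s (ρ y) = ρ (s y))
    (η₀ : F) (hη₀ : η₀ ≠ 0) (hη₀ρ : ρ η₀ = η₀) (hη₀s : s η₀ = -η₀)
    (φ : F) (hφ : φ ≠ 0) (hx : s (φ * ρ (s φ)) = φ * ρ (s φ)) :
    ∃ κ η : F, s κ = κ ∧ ρ η = η ∧ φ * ρ (s φ) = (κ * ρ κ) * (η * s η) := by
  have hsφ : s φ ≠ 0 := (map_ne_zero s).mpr hφ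
  -- the key relation: `s φ · ρ φ = φ · ρ (s φ)` (the `s`-invariance of the norm)
  have key : s φ * ρ φ = φ * ρ (s φ) := by
    have h := hx
    rw [map_mul s, hc, hs] at h
    exact h
  by_cases hsum : φ + s φ = 0
  · -- the case `s φ = −φ`: `η = η₀`, `κ = φ / η₀`
    have hneg : s φ = -φ := by linear_combination hsum
    refine ⟨φ / η₀, η₀, ?_, hη₀ρ, ?_⟩
    · rw [map_div₀, hneg, hη₀s, neg_div_neg_eq]
    · rw [map_div₀, hη₀ρ, hneg, map_neg, hη₀s]
      field_simp
  · -- the generic case: `κ = φ·s φ/(φ + s φ)`, `η = (φ + s φ)/s φ`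
    have hρsφ : ρ (s φ) ≠ 0 := (map_ne_zero ρ).mpr hsφ
    have hρsum : ρ φ + ρ (s φ) ≠ 0 := by
      intro h
      apply hsum
      have h' := congrArg ρ h
      rw [map_add, hρ, hρ, map_zero] at h'
      exact h'
    refine ⟨φ * s φ / (φ + s φ), (φ + s φ) / s φ, ?_, ?_, ?_⟩
    · rw [map_div₀, map_mul, map_add, hs]
      ring
    · rw [map_div₀, map_add]
      rw [div_eq_div_iff hρsφ hsφ]
      linear_combination key
    · rw [map_div₀ ρ, map_mul ρ, map_add ρ, map_div₀ s, map_add s, hs]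
      have h2 : φ * s φ / (φ + s φ) * (ρ φ * ρ (s φ) / (ρ φ + ρ (s φ))) * ((φ + s φ) / s φ * ((s φ + φ) / φ))
          = ρ φ * ρ (s φ) * (φ + s φ) / (ρ φ + ρ (s φ)) := by
        field_simp
        ring
      rw [h2, eq_div_iff hρsum]
      linear_combination (-(ρ (s φ))) * key

end HodgeRepro0.P2D4TripleClassesH90
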